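import Summits.ResolutionOfSingularities.ResolutionOfSingularities.Theorems.EquisingularLiftEquisingularLiftNatAOddTower
import Summits.ResolutionOfSingularities.ResolutionOfSingularities.Theorems.EquisingularLiftEquisingularLiftNatTowerVertices
import HarnessLib

/-!
# [OURS] TOWER LEVELS AT A VERTEX FROM AN AFFINE LEVEL STATEMENT, and `A_{2k+1}` VERTICES ⟹ `IsoHypPoint` (every `k`, every characteristic) — the infinite
# family ✓ `OneStep.towerLevel_origin_A_odd` (p837923) carried to `V₊(F) ⊆ ℙ³` and consumed by ✓ `isoHypPoint_of_towerVertices`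
# (cruxes `Theses.EquisingularLift.EquisingularLiftNat` / `…NatThree` / `EquisingularLift`, stmt-ResolutionOfSingularities-20038 / -20148 / -15660)

[OURS · leafhand-res-equisingularlift-12 g0, 2026-08-31; cell `pub/decomp-res`] AI-produced, weaker than expert review; NOT a statement of any manuscript;
nothing here proves resolution of singularities in positive characteristic.  DEF-FREE helper; no `sorry`; standard axioms; ZERO named hypotheses.

* ★★ `towerLevel_vertex_of_origin` — `F` a form of positive degree with vertex chart `F(x_c := 1) = Φ + Ψ` (radical); if the origin of `Spec K[T]/(Φ + Ψ)` has
  `D`-level `n`, so does the point of `V₊(F)` over `P_c` (chart block of ✓ `twoStepAt_vertex` + ✓ `OneStep.towerLevel_of_openImmersion`);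
* `SecondOrderPoint.A_odd_singular_only_origin` — `y₀y₁ + y₂^{n}` (`n ≥ 1`) is singular at most at the origin;
* ★★★ `isoHypPoint_of_A_oddVertices` — `K = K̄`; `F ∈ K[x₀,…,x₃]` a prime form whose charts at the vertices `c ∈ S` are `y₀y₁ + y₂^{2k_c+2}` (`A_{2k_c+1}`, any
  `k_c ≥ 0`) and whose other charts are regular ⟹ `IsoHypPoint K (1+2) V₊(F) ι` — every characteristic, every degree.

Honest label: closes no registered stub (certifies all `A_{odd}`-vertex surfaces OUTSIDE the isolated residual's `¬ IsoHypPoint`).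

References: [Hartshorne1977, I Thm. 5.1, I Ex. 5.6, II Prop. 5.9]; [Lipman1969, §24]; [StacksProject, Tags 0804, 080E]; through the cited tree files.
-/

set_option linter.dupNamespace false -- mandated namespace `Summit.<Summit>.<Problem>` of this single-conjunct summit

noncomputable section

open CategoryTheory CategoryTheory.Limits AlgebraicGeometry TopologicalSpace
open Literature.AlgebraicGeometry.Resolution Literature.AlgebraicGeometry.Motives
open AlgebraicGeometry.Scheme.IdealSheafData
open MvPolynomial HomogeneousLocalization
open Literature.AlgebraicGeometry.Motives.SmoothHypersurface Literature.AlgebraicGeometry.Motives.ProjectiveSpace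
open Summit.ResolutionOfSingularities.ResolutionOfSingularities.Cruxes.EquisingularLift.StrataSplit

namespace Summit.ResolutionOfSingularities.ResolutionOfSingularities.Cruxes.EquisingularLiftNat.Sections

/-- ★★ **TOWER LEVELS AT A VERTEX FROM AN AFFINE LEVEL STATEMENT.** [OURS] [cite: Hartshorne1977, II Prop. 5.9] [cite: StacksProject, Tag 0804] -/
theorem towerLevel_vertex_of_origin (K : Type) [Field K] {m : ℕ} (D : ℕ → ∀ Γ : Scheme.{0}, Γ → Prop)
    (hD0 : ∀ (Γ : Scheme.{0}) (y : Γ), IsClosed (({y} : Set Γ)) →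
      (D 0 Γ y ↔ ∀ (hy : IsClosed (({y} : Set Γ))) (Z : Scheme.{0}) (τ : Z ⟶ Γ), IsBlowup τ (vanishingIdeal ⟨{y}, hy⟩) →
        ∀ z : Z, τ z = y → IsRegularLocalRing (Z.presheaf.stalk z)))
    (hDsucc : ∀ (d : ℕ) (Γ : Scheme.{0}) (y : Γ), IsClosed (({y} : Set Γ)) →
      (D (d + 1) Γ y ↔ ∀ (hy : IsClosed (({y} : Set Γ))) (Z : Scheme.{0}) (τ : Z ⟶ Γ), IsBlowup τ (vanishingIdeal ⟨{y}, hy⟩) →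
        ∃ S' : Finset Z, (∀ z : Z, τ z = y → z ∉ S' → IsRegularLocalRing (Z.presheaf.stalk z)) ∧
          ∀ z ∈ S', τ z = y ∧ IsClosed (({z} : Set Z)) ∧ ∃ d' ≤ d, D d' Z z))
    (n : ℕ) (F : MvPolynomial (Fin (m + 2 + 1)) K) {d₀ : ℕ} (hF : F.IsHomogeneous d₀) (hd : 0 < d₀)
    (c : Fin (m + 2 + 1)) (Φ Ψ : MvPolynomial (Fin (m + 2)) K) {μ : ℕ} (hμ : 1 ≤ μ) (hΦ : Φ.IsHomogeneous μ)
    (hΨ : Ψ ∈ Ideal.span (Set.range (X : Fin (m + 2) → MvPolynomial (Fin (m + 2)) K)) ^ (μ + 1))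
    (hdeh : ProjectiveSpace.dehomogenize K c F = Φ + Ψ) (hrad : (Ideal.span {Φ + Ψ}).radical = Ideal.span {Φ + Ψ})
    (horigin : ∀ y : Spec (CommRingCat.of (MvPolynomial (Fin (m + 2)) K ⧸ Ideal.span {Φ + Ψ})),
      y.asIdeal = Ideal.map (Ideal.Quotient.mk (Ideal.span {Φ + Ψ})) (Ideal.span (Set.range (X : Fin (m + 2) → MvPolynomial (Fin (m + 2)) K))) →
      D n (Spec (CommRingCat.of (MvPolynomial (Fin (m + 2)) K ⧸ Ideal.span {Φ + Ψ}))) y) :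
    letI := MvPolynomial.gradedAlgebra (σ := Fin (m + 2 + 1)) (R := K)
    ∃ (x₀ : ↥(hypersurface F).left) (_ : IsClosed ({x₀} : Set ↥(hypersurface F).left)),
      (∀ a : Fin (m + 2 + 1), a ≠ c → (X a : MvPolynomial (Fin (m + 2 + 1)) K) ∈ ((hypersurfaceι F).left x₀).asHomogeneousIdeal) ∧
      D n (hypersurface F).left x₀ := by
  letI := MvPolynomial.gradedAlgebra (σ := Fin (m + 2 + 1)) (R := K)
  letI := MvPolynomial.gradedAlgebra (σ := Fin (0 + 1)) (R := K)
  letI := ProjBaseChange.algebraBase (R := K) (homogeneousSubmodule (Fin (m + 2 + 1)) K)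
    (Submonoid.powers (X c : MvPolynomial (Fin (m + 2 + 1)) K))
  classical
  -- the kill map of the vertex `P_c`
  have he : Function.Injective (fun _ : Fin 1 => c) := Function.injective_of_subsingleton _
  obtain ⟨fk, hfk', hfkC, hfke, hfk0⟩ := LinearCentre.exists_kill (R := K) (fun _ : Fin 1 => c) he
  have hfke' : ∀ j : Fin 1, fk (X c) = X j := fun j => hfke j
  have hfk0' : ∀ i : Fin (m + 2 + 1), i ≠ c → fk (X i) = 0 := fun i hi => hfk0 i (fun ⟨_, hj⟩ => hi hj.symm)
  -- the vertex point
  obtain ⟨x₀, hx₀cl, hx₀cl', hsupp, hx₀X, hΛ, hcomap⟩ :=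
    exists_vertexPoint K F hF c ⟨μ, Φ, Ψ, hμ, hΦ, hΨ, hdeh⟩ fk hfk' hfkC hfke' hfk0'
  refine ⟨x₀, hx₀cl', hx₀X, ?_⟩
  -- the chart `ψ = Spec θ ≫ chart F c`
  obtain ⟨θ, hθ⟩ := HypersurfaceSpecimen.exists_chartQuotEquiv F hF c (Φ + Ψ) hdeh hrad
  let ψ : Spec (CommRingCat.of (MvPolynomial (Fin (m + 2)) K ⧸ Ideal.span {Φ + Ψ})) ⟶ (hypersurface F).left :=
    Spec.map θ.toCommRingCatIso.hom ≫ (chart F c hF hd).left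
  haveI : IsOpenImmersion (Spec.map θ.toCommRingCatIso.hom) := IsOpenImmersion.of_isIso _
  haveI : @IsOpenImmersion (Spec (CommRingCat.of (ChartRing F c hF))) _ (chart F c hF hd).left :=
    isOpenImmersion_chart_left F c hF hd
  haveI : IsOpenImmersion ψ := IsOpenImmersion.comp _ _
  -- the origin and its image
  let y₀ : Spec (CommRingCat.of (MvPolynomial (Fin (m + 2)) K ⧸ Ideal.span {Φ + Ψ})) :=
    ⟨Ideal.map (Ideal.Quotient.mk (Ideal.span {Φ + Ψ})) (Ideal.span (Set.range (X : Fin (m + 2) → MvPolynomial (Fin (m + 2)) K))),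
      (OneStep.isMaximal_map_mk_span_range_X K Φ Ψ hμ hΦ hΨ).isPrime⟩
  have hy₀ : y₀.asIdeal = Ideal.map (Ideal.Quotient.mk (Ideal.span {Φ + Ψ}))
      (Ideal.span (Set.range (X : Fin (m + 2) → MvPolynomial (Fin (m + 2)) K))) := rfl
  -- the vertex ideal pulled back to the chart is the origin ideal of `ChartRing F c`
  have hchart := HypersurfaceSpecimen.comap_chart_eq_ofIdealTop K F hF hd (fun _ : Fin 1 => c) he fk hfk' hfkC hfke hfk0 c
  -- the origin ideal of `ChartRing F c` goes into the origin ideal of `K[y]/(f)` under `θ`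
  have hI₀ : ∀ q ∈ Ideal.span (Set.range fun a : {a : Fin (m + 2 + 1) // a ∉ Set.range (fun _ : Fin 1 => c)} => tautVec F c hF a.1),
      θ q ∈ y₀.asIdeal := by
    intro q hq
    have hle : Ideal.span (Set.range fun a : {a : Fin (m + 2 + 1) // a ∉ Set.range (fun _ : Fin 1 => c)} => tautVec F c hF a.1) ≤
        y₀.asIdeal.comap θ.toRingHom := by
      rw [Ideal.span_le]
      rintro _ ⟨⟨a, ha⟩, rfl⟩
      obtain ⟨j, hj⟩ : ∃ j : Fin (m + 2), c.succAbove j = a := Fin.exists_succAbove_eq (fun h => ha ⟨0, h.symm⟩)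
      rw [SetLike.mem_coe, Ideal.mem_comap]
      change θ (tautVec F c hF a) ∈ y₀.asIdeal
      rw [← hj, hθ j, hy₀]
      exact Ideal.mem_map_of_mem _ (Ideal.subset_span ⟨j, rfl⟩)
    exact hle hq
  have hψx : ψ y₀ = x₀ := by
    -- the point `p₀ = Spec θ (y₀)` of the chart lies on the pulled-back vertex ideal
    have hsurj : Function.Surjective (Scheme.ΓSpecIso (CommRingCat.of (ChartRing F c hF))).inv :=
      (ConcreteCategory.bijective_of_isIso (C := CommRingCat) (Scheme.ΓSpecIso (CommRingCat.of (ChartRing F c hF))).inv).2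
    have hinj : Function.Injective (Scheme.ΓSpecIso (CommRingCat.of (ChartRing F c hF))).inv :=
      (ConcreteCategory.bijective_of_isIso (C := CommRingCat) (Scheme.ΓSpecIso (CommRingCat.of (ChartRing F c hF))).inv).1
    -- the chart morphism with source typed as `Spec (ChartRing F c)`
    have hchart' : Scheme.IdealSheafData.comap (X := Spec (CommRingCat.of (ChartRing F c hF)))
        (((Proj.map fk hfk').ker.comap (hypersurfaceι F).left)) (chart F c hF hd).left =
        ofIdealTop ((Ideal.span (Set.range fun a : {a : Fin (m + 2 + 1) // a ∉ Set.range (fun _ : Fin 1 => c)} => tautVec F c hF a.1)).map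
          (Scheme.ΓSpecIso (CommRingCat.of (ChartRing F c hF))).inv.hom) := hchart
    have hp : Spec.map θ.toCommRingCatIso.hom y₀ ∈
        ((Scheme.IdealSheafData.comap (X := Spec (CommRingCat.of (ChartRing F c hF)))
          (((Proj.map fk hfk').ker.comap (hypersurfaceι F).left)) (chart F c hF hd).left).support :
            Set (Spec (CommRingCat.of (ChartRing F c hF)))) := by
      rw [hchart', Scheme.IdealSheafData.coe_support_ofIdealTop, Spec_zeroLocus, Spec.map_apply]
      refine (PrimeSpectrum.mem_zeroLocus _ _).mpr ?_
      intro r hr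
      obtain ⟨r', hr', hrr'⟩ := (Ideal.mem_map_iff_of_surjective _ hsurj).mp hr
      have hr'' : r = r' := hinj hrr'.symm
      subst hr''
      rw [SetLike.mem_coe, PrimeSpectrum.comap_asIdeal, Ideal.mem_comap]
      exact hI₀ r hr'
    rw [Scheme.IdealSheafData.support_comap] at hp
    change (chart F c hF hd).left (Spec.map θ.toCommRingCatIso.hom y₀) ∈
      ((((Proj.map fk hfk').ker.comap (hypersurfaceι F).left)).support : Set ↥(hypersurface F).left) at hp
    rw [hcomap, Scheme.IdealSheafData.coe_support_vanishingIdeal] at hp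
    exact hp
  have hy₀cl : IsClosed ({y₀} : Set (Spec (CommRingCat.of (MvPolynomial (Fin (m + 2)) K ⧸ Ideal.span {Φ + Ψ})))) :=
    (PrimeSpectrum.isClosed_singleton_iff_isMaximal y₀).mpr (OneStep.isMaximal_map_mk_span_range_X K Φ Ψ hμ hΦ hΨ)
  exact OneStep.towerLevel_of_openImmersion D hD0 hDsucc n ψ hψx hy₀cl hx₀cl' (horigin y₀ hy₀)

/-- **`y₀y₁ + y₂ⁿ` (`n ≥ 1`) is singular at most at the origin**: `∂₀ = y₁`, `∂₁ = y₀`, `y₂ⁿ = f − y₀y₁`. [cite: Hartshorne1977, I Thm. 5.1] -/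
theorem SecondOrderPoint.A_odd_singular_only_origin (K : Type) [Field K] {n : ℕ} (hn : 1 ≤ n)
    (P : Ideal (MvPolynomial (Fin 3) K)) (hP : P.IsPrime) (hf : (X 0 * X 1 + X 2 ^ n : MvPolynomial (Fin 3) K) ∈ P)
    (hd : ∀ j, pderiv j (X 0 * X 1 + X 2 ^ n : MvPolynomial (Fin 3) K) ∈ P) (j : Fin 3) :
    (X j : MvPolynomial (Fin 3) K) ∈ P := by
  have hd0 : pderiv 0 (X 0 * X 1 + X 2 ^ n : MvPolynomial (Fin 3) K) = X 1 := by
    rw [map_add, pderiv_mul, pderiv_X_self, pderiv_X_of_ne (by decide : (1 : Fin 3) ≠ 0), pderiv_pow,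
      pderiv_X_of_ne (by decide : (2 : Fin 3) ≠ 0)]
    ring
  have hd1 : pderiv 1 (X 0 * X 1 + X 2 ^ n : MvPolynomial (Fin 3) K) = X 0 := by
    rw [map_add, pderiv_mul, pderiv_X_of_ne (by decide : (0 : Fin 3) ≠ 1), pderiv_X_self, pderiv_pow,
      pderiv_X_of_ne (by decide : (2 : Fin 3) ≠ 1)]
    ring
  have hX1 : (X 1 : MvPolynomial (Fin 3) K) ∈ P := by rw [← hd0]; exact hd 0
  have hX0 : (X 0 : MvPolynomial (Fin 3) K) ∈ P := by rw [← hd1]; exact hd 1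
  have hX2 : (X 2 : MvPolynomial (Fin 3) K) ∈ P := by
    refine hP.mem_of_pow_mem n ?_
    have e : (X 2 ^ n : MvPolynomial (Fin 3) K) = (X 0 * X 1 + X 2 ^ n) - X 0 * X 1 := by ring
    rw [e]
    exact P.sub_mem hf (P.mul_mem_left _ hX1)
  have _ := hn
  fin_cases j
  · simpa using hX0
  · simpa using hX1
  · simpa using hX2

/-- ★★★ **`A_{2k+1}` VERTICES ⟹ `IsoHypPoint`** (`K = K̄`, every characteristic): `F ∈ K[x₀,…,x₃]` a prime form whose charts at the vertices `c ∈ S` are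
`y₀y₁ + y₂^{2k_c+2}` and whose other charts are regular. [OURS] [cite: Hartshorne1977, I Thm. 5.1, I Ex. 5.6] [cite: StacksProject, Tag 080E] -/
theorem isoHypPoint_of_A_oddVertices (K : Type) [Field K] [IsAlgClosed K]
    (F : MvPolynomial (Fin (1 + 2 + 1)) K) {d : ℕ} (hF : F.IsHomogeneous d) (hFp : Prime F) (S : List (Fin (1 + 2 + 1)))
    (kexp : Fin (1 + 2 + 1) → ℕ)
    (hA : ∀ c ∈ S, ProjectiveSpace.dehomogenize K c F = X 0 * X 1 + X 2 ^ (2 * kexp c + 2))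
    (hoff : letI := MvPolynomial.gradedAlgebra (σ := Fin (1 + 2 + 1)) (R := K)
      ∀ c, c ∉ S → IsRegularRing (ChartRing F c hF)) :
    letI := MvPolynomial.gradedAlgebra (σ := Fin (1 + 2 + 1)) (R := K)
    IsoHypPoint K (1 + 2) (hypersurface F).left (hypersurfaceι F).left := by
  obtain ⟨D, hD0, hDsucc⟩ := exists_blowupTower
  have hd : 0 < d := ConeN.pos_of_prime_of_isHomogeneous K F hF hFp
  have hΦ : (X 0 * X 1 : MvPolynomial (Fin 3) K).IsHomogeneous 2 := by
    simpa using (isHomogeneous_X K (0 : Fin 3)).mul (isHomogeneous_X K (1 : Fin 3))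
  have hnode : (X 0 * X 1 + X 2 ^ 2 : MvPolynomial (Fin 3) K).IsHomogeneous 2 := by
    refine IsHomogeneous.add ?_ (isHomogeneous_X_pow 2 2)
    simpa using (isHomogeneous_X K (0 : Fin 3)).mul (isHomogeneous_X K (1 : Fin 3))
  -- a uniform split of the chart `y₀y₁ + y₂^{2k+2}` with `μ = 2`
  have hsplit : ∀ c ∈ S, ∃ (Φ Ψ : MvPolynomial (Fin (1 + 2)) K), Φ.IsHomogeneous 2 ∧
      Ψ ∈ Ideal.span (Set.range (X : Fin (1 + 2) → MvPolynomial (Fin (1 + 2)) K)) ^ (2 + 1) ∧ ProjectiveSpace.dehomogenize K c F = Φ + Ψ ∧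
      Φ + Ψ = X 0 * X 1 + X 2 ^ (2 * kexp c + 2) := by
    intro c hc
    rcases Nat.eq_zero_or_pos (kexp c) with hk | hk
    · refine ⟨X 0 * X 1 + X 2 ^ 2, 0, hnode, Ideal.zero_mem _, ?_, ?_⟩
      · rw [hA c hc, hk]; ring
      · rw [hk]; ring
    · exact ⟨X 0 * X 1, X 2 ^ (2 * kexp c + 2), hΦ, SecondOrderPoint.X_two_pow_mem_pow_three K (by omega), hA c hc, rfl⟩
  refine isoHypPoint_of_towerVertices K D hD0 hDsucc F hF hFp S (fun c hc => ?_) (fun c hc P hP hfP hdP j => ?_) hoff (fun c hc => ?_)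
  · obtain ⟨Φ, Ψ, hΦ', hΨ', hdeh, -⟩ := hsplit c hc
    exact ⟨2, Φ, Ψ, le_rfl, hΦ', hΨ', hdeh⟩
  · rw [hA c hc] at hfP hdP
    exact SecondOrderPoint.A_odd_singular_only_origin K (by omega) P hP hfP hdP j
  · obtain ⟨Φ, Ψ, hΦ', hΨ', hdeh, hsum⟩ := hsplit c hc
    have hrad : (Ideal.span {Φ + Ψ}).radical = Ideal.span {Φ + Ψ} :=
      OrdPointAt.radical_span_dehomogenize_eq K F c hF hFp Φ Ψ hΦ' (by norm_num) hΨ' hdeh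
    obtain ⟨x₀, -, hx₀X, hlev⟩ := towerLevel_vertex_of_origin K D hD0 hDsucc (kexp c) F hF hd c Φ Ψ (by norm_num) hΦ' hΨ' hdeh hrad
      (fun y hy => OneStep.towerLevel_origin_A_odd K D hD0 hDsucc (kexp c) (Φ + Ψ) hsum y hy)
    exact ⟨x₀, hx₀X, kexp c, hlev⟩

end Summit.ResolutionOfSingularities.ResolutionOfSingularities.Cruxes.EquisingularLiftNat.Sections

end
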